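import Literature.MathematicalPhysics.QuantumFieldTheory.Balaban1983to89.B10Eq2HaarCompatibility

/-!
# BalabanUVNodes ∕ N08 — THE E6′ LETTERS INHABITED at fine-lattice members of the [B10] run family OF RECORD: where exact Haar compatibility of
# print's averaging HOLDS outright (an instance exhibited), where it is the undecided «T1 =ᵐ 1» question (displayed, not decided), the side-2
# members the question bites (N22-F in kernel form), and a degenerate-group consistency witness

WIDTH SEAT `pub-ymgap-dag-n08-w3` g0 (HUMAN RULING D-0149 work-bound push; chair R461; plan g77 `W-SEAT-START-LIST.md` v2 §n08 item 3
«the Haar-compatibility ∕ E6′ letters' NON-VACUITY at one fine-lattice [member] of record … exhibit one inhabited instance at the record's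
`B10RunsOfRecord`»), 2026-08-27.  Track A, DAG node N08 = [Balaban1985UV3] T. Bałaban, *Ultraviolet stability of three-dimensional lattice pure
gauge field theories*, Commun. Math. Phys. **102** (1985) 255–275, Thm 1 p. 257 (compact reading) + Thm 2 p. 272; key item K1⁷
`StabilityBAtRecordR13SepCoPH` (stmt-QuantumFields-20542), filed `--supports … --as helper`.  COUNT-NEUTRAL.

THE LETTERS.  Seat dag-n08-a g6's `Literature/…/B10Eq2HaarCompatibility.lean` (p434996; its SEAM note `HOME/pub-ymgap-dag-n08-a/N08-COUNT-PATH-SEAM-E6.md`)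
states «E6′» — EXACT HAAR COMPATIBILITY `Ū_*(dU) = dV` of an averaging — in the letters of N08's slot of record `Node00.PrintedUV3V N L`
(def-T `Node00/CarriersB10.lean`): for every version `T` of [Balaban1985Averaging] (10) along a measurable averaging `Ū`, `Ū_*(dU) = (T1)·dV`, hence
`HaarAC Ū`, and `Ū_*(dU) = dV ⟺ T1 =ᵐ 1`; at print's averaging `B10RunsOfRecord.avOfPrint N S j` (Bałaban's block averaging [Balaban1987RG1] (0.4) in the
standing range `j + 1 ≤ m + K`, the transport relabelling beyond it) E6′ HOLDS beyond the range and is, inside it, the biconditional with «T1 =ᵐ 1» for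
every transformation family `𝔗 : Node00.TFamily₃ N L` — NOT IN PRINT and undecided at `N ≥ 2` (pub-balaban3d DEPMAP v6 §16 N22; chair R451).  Those
letters are universally quantified over binders (`S : Scales L`, a level `j`, a version `T`, a family `𝔗`, measurability of `Ū`).

WHAT THIS FILE PROVES (kernel bookkeeping BY NAME over landed modules — `B10Eq2HaarCompatibility`, `B10RunsOfRecord` v1.2, `Node00.CarriersB10`; nothing
of Bałaban's asserted; NOTHING decided about E6′ inside the standing range at `N ≥ 2`):
* §1 `exists_member_runsB10OfRecord` — for every odd `L > 1`, every coupling `g > 0`, every volume exponent `m` and EVERY depth `K`, the index family of the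
  run family OF RECORD `Node00.runsB10OfRecord N L` (`= Family L (constsOfRecordG N (runObjects₀T N (tOfRecord₃ N L) (Backgrounds.ofPrint N L))).eps0`) has a
  member with exactly that `(g, m, K)`: ARBITRARILY FINE LATTICES OF RECORD (spacing `ε = ε₀(g)·L^{−K}`; dag-n08-a's `exists_family_member` at
  `constsOfRecordG_adm`).
* §2 THE BINDERS INHABITED AT EVERY MEMBER AND LEVEL BY PRINT'S OWN OBJECTS: `haarAC_avOfPrint` — `HaarAC (avOfPrint N S j).avg` at EVERY level `j`, in AND
  beyond the standing range, from the mere existence of print's hypothesis-free version `TOfPrint N S j` (in range this is lit-balaban's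
  `hac_expMeanLogSU_SUN` read through the letters; beyond it the relabelling); `map_avOfPrint_eq_withDensity_TOfPrint_one` — `Ū_*(dU) = (T1)·dV` at
  `𝔗 := TOfPrint N`; `map_avOfPrint_eq_iff_TOfPrint_one` ∕ `map_avOfPrint_eq_iff_tOfRecord₃_one` — E6′ ⟺ «T1 =ᵐ 1» for print's `TOfPrint` and for THE
  TRANSFORMATIONS OF RECORD `Node00.tOfRecord₃ N L` (the version the run family of record is built over).
* §3 THE INHABITED INSTANCE: `map_avOfPrint_eq_of_le` ∕ `T_one_ae_eq_one_of_le` — at every member and every level `j ≥ m + K` E6′ HOLDS and EVERY version of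
  (10) fixes `1` a.e.; `forall_map_avOfPrint_eq_iff_inRange` — a displayed E6′ hypothesis (SEAM (R-d)) is owed at the in-range levels only; the headline
  `exists_member_level_map_avOfPrint_eq` — a member OF RECORD with any prescribed `(g, m, K)` and a level at which E6′ AND its
  letter-equivalent «`(𝔗 S j).T 1 =ᵐ 1` for EVERY `𝔗 : TFamily₃ N L`» both hold.  So the letters are not vacuous at the record: their binders are inhabited
  and their conclusion has true instances on arbitrarily fine lattices of record.
* §4 WHERE THE QUESTION BITES (N22-F of the SEAM note §0 in kernel form): `sitesPerDir_K_eq` (`T₁^{(K)}` has `2·L^m` sites per direction),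
  `sitesPerDir_K_of_m_eq_zero` (`m = 0 ⇒ 2`), `exists_member_m_zero` — for every `K ≥ 1` the family of record contains `m = 0` members; their LAST RUN STEP
  `avOfPrint N S (K − 1)` is IN the standing range and averages onto the torus with 2 sites per direction (the regime whose d = 2 analogue pub-balaban3d's
  Monte-Carlo found violating E6′); there E6′ is displayed as the undecided biconditional only (`map_avOfPrint_eq_iff_TOfPrint_one_last_step`).
* §5 DEGENERATE-GROUP CONSISTENCY WITNESS: at `N = 1` (`SU(1)` is one point) E6′ holds at EVERY level, in range too (`map_avOfPrint_eq_SU_one`), hence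
  «T1 =ᵐ 1» for every family there (`T_one_ae_eq_one_SU_one`) — the in-range letters are SATISFIABLE; explicitly NOT evidence at the pin's `N = 2`
  (K1⁷ v5 pins `Node00.PrintedUV3V 2 θ.L`), where the in-range identity stays undecided.

HONEST FRAMING.  Count-neutral helper; N08 NOT discharged; counts unmoved (typed 28∕28 · discharged 5∕27); E6′ for [Balaban1985Averaging] (15) on `SU(2)`
inside the standing range remains NOT IN PRINT and undecided (SEAM note §2; R451: the primed slot `PrintedUV3V'` is the honest reading, not a supplier).
One finite 𝕋⁴ programme at fixed ε (the d = 3 lattices of [B10] inside the d = 4 record); R4 closes the CONDITIONAL rung `BalabanLadder.UV` only; the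
Yang–Mills mass gap (Clay) is NOT proved by any of this; nothing continuum ∕ ℝ³ ∕ ℝ⁴ ∕ infinite volume ∕ OS ∕ mass gap.  0 `sorry`, 0 `def`, 0 `instance`,
standard axioms.
-/

noncomputable section

open MeasureTheory

namespace Summit.QuantumFields.YangMills.BalabanUVNodes.N08HaarCompatibilityInhabited

open Literature.MathematicalPhysics.QuantumFieldTheory.Balaban1983to89
open Literature.MathematicalPhysics.QuantumFieldTheory.Balaban1985CMP102.Setting (Scales)
open Literature.MathematicalPhysics.QuantumFieldTheory.Balaban1985CMP102.Theorems (Family)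
open Literature.MathematicalPhysics.QuantumFieldTheory.Balaban1983to89.B10RunsOfRecord
  (avOfPrint TOfPrint Consts Backgrounds constsOfRecordG constsOfRecordG_adm runObjects₀T exists_family_member)
open Literature.MathematicalPhysics.QuantumFieldTheory.Balaban1983to89.B10Eq2HaarCompatibility
open Literature.MathematicalPhysics.QuantumFieldTheory.Balaban1983to89.Node00 (SU TFamily₃ tOfRecord₃ runsB10OfRecord)
open Literature.MathematicalPhysics.QuantumFieldTheory.Balaban1983to89.T4FiniteEpsInhabited (HaarAC)

variable (N : ℕ) [NeZero N] {L : ℕ}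

/-! ## §1. Arbitrarily fine lattices in the run family OF RECORD -/

/-- **Fine-lattice members OF RECORD**: for every odd `L > 1`, coupling `g > 0`, volume exponent `m` and EVERY number of steps `K`, the index family of the
[B10] run family of record `Node00.runsB10OfRecord N L` has a member with that coupling, volume exponent and depth (spacing `ε₀(g)L^{−K}`).
[cite: Balaban1985UV3, p.256 L15–18 (bookkeeping: dag-n08-a's `exists_family_member` at the constants of record)] -/
theorem exists_member_runsB10OfRecord (hL : Odd L ∧ 1 < L) (g : ℝ) (hg : 0 < g) (m K : ℕ) :
    ∃ S : Family L (constsOfRecordG N (runObjects₀T N (tOfRecord₃ N L) (Backgrounds.ofPrint N L))).eps0,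
      S.1.g = g ∧ S.1.m = m ∧ S.1.K = K :=
  exists_family_member hL _ (constsOfRecordG_adm N _) g hg m K

/-- The same, displayed against the run family of record itself: the member is an index of `runsB10OfRecord N L` (whose value there is a `B10.RunData`).
[cite: Balaban1985UV3, p.256 L15–18 (bookkeeping)] -/
theorem exists_index_runsB10OfRecord (hL : Odd L ∧ 1 < L) (g : ℝ) (hg : 0 < g) (m K : ℕ) :
    ∃ S, (runsB10OfRecord N L S).K = K ∧ S.1.g = g ∧ S.1.m = m ∧ S.1.K = K := by
  obtain ⟨S, hSg, hSm, hSK⟩ := exists_member_runsB10OfRecord N hL g hg m K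
  exact ⟨S, hSK, hSg, hSm, hSK⟩

/-! ## §2. The letters' binders inhabited at every member and level by print's own objects -/

/-- The version family of the slot is inhabited by print's hypothesis-free transformations `TOfPrint N`. [cite: Balaban1985UV3, (2) p.256 (bookkeeping)] -/
theorem tFamily₃_nonempty : Nonempty (TFamily₃ N L) := ⟨TOfPrint N⟩

/-- **`HaarAC` OF PRINT'S AVERAGING AT EVERY LEVEL** (in and beyond the standing range), from the mere existence of the version `TOfPrint N S j` of (10) along it
(`haarAC_of_rtOpI`). [cite: Balaban1985Averaging, (10) + (15) p.19 (bookkeeping)] -/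
theorem haarAC_avOfPrint (S : Scales L) (j : ℕ) : HaarAC (avOfPrint N S j).avg :=
  haarAC_of_rtOpI (TOfPrint N S j) (measurable_avOfPrint N S j)

/-- **`Ū_*(dU) = (T1)·dV` at print's own version**: the image of `dU` under `avOfPrint N S j` is `dV` with density `(TOfPrint N S j).T 1`.
[cite: Balaban1985Averaging, (10) p.19 (bookkeeping)] -/
theorem map_avOfPrint_eq_withDensity_TOfPrint_one (S : Scales L) (j : ℕ) :
    (fieldMeasure S.P j (SU N)).map (avOfPrint N S j).avg =
      (fieldMeasure S.P (j + 1) (SU N)).withDensity fun V => ENNReal.ofReal ((TOfPrint N S j).T 1 V) :=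
  map_avg_eq_withDensity_T_one (TOfPrint N S j) (measurable_avOfPrint N S j)

/-- `∫ (TOfPrint N S j).T 1 dV = 1` (total mass; print's (6) at the constant density). [cite: Balaban1985UV3, (6) p.257 (bookkeeping)] -/
theorem integral_TOfPrint_one (S : Scales L) (j : ℕ) : ∫ V, (TOfPrint N S j).T 1 V ∂(fieldMeasure S.P (j + 1) (SU N)) = 1 :=
  integral_T_one (TOfPrint N S j)

/-- **E6′ ⟺ «T1 =ᵐ 1» FOR PRINT'S OWN VERSION `TOfPrint`**, every member and level. [cite: Balaban1985Averaging, (10) + (15) p.19 (bookkeeping; E6′ itself NOT IN PRINT)] -/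
theorem map_avOfPrint_eq_iff_TOfPrint_one (S : Scales L) (j : ℕ) :
    (fieldMeasure S.P j (SU N)).map (avOfPrint N S j).avg = fieldMeasure S.P (j + 1) (SU N) ↔
      (TOfPrint N S j).T 1 =ᵐ[fieldMeasure S.P (j + 1) (SU N)] 1 :=
  map_avOfPrint_eq_iff N S j (TOfPrint N)

variable (L) in
/-- **E6′ ⟺ «T1 =ᵐ 1» FOR THE TRANSFORMATIONS OF RECORD `Node00.tOfRecord₃ N L`** (the version family the run family of record `runsB10OfRecord N L` is built
over), every member and level. [cite: Balaban1985UV3, (2) p.256; Balaban1985Averaging, (10) p.19 (bookkeeping; E6′ NOT IN PRINT)] -/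
theorem map_avOfPrint_eq_iff_tOfRecord₃_one (S : Scales L) (j : ℕ) :
    (fieldMeasure S.P j (SU N)).map (avOfPrint N S j).avg = fieldMeasure S.P (j + 1) (SU N) ↔
      (tOfRecord₃ N L S j).T 1 =ᵐ[fieldMeasure S.P (j + 1) (SU N)] 1 :=
  map_avOfPrint_eq_iff N S j (tOfRecord₃ N L)

/-! ## §3. The inhabited instance: beyond the standing range E6′ holds at every member -/

/-- **E6′ HOLDS at every level `j ≥ m + K`** of every member (there print's averaging of record is the transport relabelling).
[cite: Balaban1985UV3, (2) p.256 (bookkeeping)] -/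
theorem map_avOfPrint_eq_of_le (S : Scales L) {j : ℕ} (hj : S.P.m + S.P.K ≤ j) :
    (fieldMeasure S.P j (SU N)).map (avOfPrint N S j).avg = fieldMeasure S.P (j + 1) (SU N) :=
  map_avOfPrint_eq_of_not_le N S j (by omega)

variable (L) in
/-- … so at those levels EVERY version of (10) along print's averaging fixes the constant density a.e. [cite: Balaban1985Averaging, (10) p.19 (bookkeeping)] -/
theorem T_one_ae_eq_one_of_le (𝔗 : TFamily₃ N L) (S : Scales L) {j : ℕ} (hj : S.P.m + S.P.K ≤ j) :
    (𝔗 S j).T 1 =ᵐ[fieldMeasure S.P (j + 1) (SU N)] 1 :=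
  T_one_ae_eq_one_of_not_le N S j 𝔗 (by omega)

/-- At the first level beyond the range, `j = m + K`, both sides of the E6′ biconditional hold for print's own version. [cite: Balaban1985UV3, (2) p.256 (bookkeeping)] -/
theorem map_avOfPrint_eq_and_TOfPrint_one_top (S : Scales L) :
    (fieldMeasure S.P (S.P.m + S.P.K) (SU N)).map (avOfPrint N S (S.P.m + S.P.K)).avg = fieldMeasure S.P (S.P.m + S.P.K + 1) (SU N) ∧
      (TOfPrint N S (S.P.m + S.P.K)).T 1 =ᵐ[fieldMeasure S.P (S.P.m + S.P.K + 1) (SU N)] 1 :=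
  ⟨map_avOfPrint_eq_of_le N S le_rfl, T_one_ae_eq_one_of_le N L (TOfPrint N) S le_rfl⟩

/-- **A DISPLAYED E6′ HYPOTHESIS IS OWED IN THE STANDING RANGE ONLY** (SEAM note §3 (R-d)'s `hHaar` reduced): exact Haar compatibility of print's averaging
at every level of a member ⟺ the same at its in-range levels `j + 1 ≤ m + K` (beyond them it is automatic). [cite: Balaban1985UV3, (2) p.256 (bookkeeping)] -/
theorem forall_map_avOfPrint_eq_iff_inRange (S : Scales L) :
    (∀ j, (fieldMeasure S.P j (SU N)).map (avOfPrint N S j).avg = fieldMeasure S.P (j + 1) (SU N)) ↔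
      ∀ j, j + 1 ≤ S.P.m + S.P.K → (fieldMeasure S.P j (SU N)).map (avOfPrint N S j).avg = fieldMeasure S.P (j + 1) (SU N) :=
  ⟨fun h j _ => h j, fun h j => by
    by_cases hj : j + 1 ≤ S.P.m + S.P.K
    · exact h j hj
    · exact map_avOfPrint_eq_of_not_le N S j hj⟩

/-- **THE INHABITED INSTANCE AT THE RECORD**: for every odd `L > 1`, `g > 0`, `m` and EVERY depth `K` there are a member `S` of the index family of the run family
OF RECORD with that `(g, m, K)` and a level `j` at which exact Haar compatibility of print's averaging HOLDS and every transformation family of the slot fixes `1`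
a.e. — the E6′ letters have a true instance on arbitrarily fine lattices of record. [cite: Balaban1985UV3, (2) p.256, p.256 L15–18 (bookkeeping)] -/
theorem exists_member_level_map_avOfPrint_eq (hL : Odd L ∧ 1 < L) (g : ℝ) (hg : 0 < g) (m K : ℕ) :
    ∃ S : Family L (constsOfRecordG N (runObjects₀T N (tOfRecord₃ N L) (Backgrounds.ofPrint N L))).eps0,
      S.1.g = g ∧ S.1.m = m ∧ S.1.K = K ∧
        ∃ j, (fieldMeasure S.1.P j (SU N)).map (avOfPrint N S.1 j).avg = fieldMeasure S.1.P (j + 1) (SU N) ∧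
          ∀ 𝔗 : TFamily₃ N L, (𝔗 S.1 j).T 1 =ᵐ[fieldMeasure S.1.P (j + 1) (SU N)] 1 := by
  obtain ⟨S, hSg, hSm, hSK⟩ := exists_member_runsB10OfRecord N hL g hg m K
  exact ⟨S, hSg, hSm, hSK, S.1.P.m + S.1.P.K, map_avOfPrint_eq_of_le N S.1 le_rfl,
    fun 𝔗 => T_one_ae_eq_one_of_le N L 𝔗 S.1 le_rfl⟩

/-! ## §4. Where the in-range question bites: the last run step of an `m = 0` member averages onto the side-2 torus -/

/-- The lattice `T₁^{(K)}` on which the [B10] run terminates has `2·L^m` sites per direction. [cite: Balaban1985UV3, p.256 L15–18; Balaban1987RG1, (0.1) p.251 (bookkeeping)] -/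
theorem sitesPerDir_K_eq (S : Scales L) : S.P.sitesPerDir S.P.K = 2 * L ^ S.P.m := by
  show 2 * L ^ (S.m + S.K - S.K) = 2 * L ^ S.m
  rw [Nat.add_sub_cancel]

/-- **N22-F in kernel form**: a member with volume exponent `m = 0` terminates on the torus with 2 sites per direction. [cite: Balaban1987RG1, (0.1) p.251 (bookkeeping)] -/
theorem sitesPerDir_K_of_m_eq_zero (S : Scales L) (hm : S.m = 0) : S.P.sitesPerDir S.P.K = 2 := by
  rw [sitesPerDir_K_eq S]
  show 2 * L ^ S.m = 2
  rw [hm, pow_zero, mul_one]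

/-- For an `m = 0` member with `K ≥ 1` steps the LAST RUN STEP `j = K − 1` is IN the standing range (`j + 1 ≤ m + K`), so the averaging there IS Bałaban's block
averaging (0.4) and it lands on the side-2 torus. [cite: Balaban1987RG1, (0.1) + (0.4) pp.251–253 (bookkeeping)] -/
theorem last_step_in_range_of_m_eq_zero (S : Scales L) (hm : S.m = 0) (hK : 1 ≤ S.K) :
    (S.K - 1) + 1 ≤ S.P.m + S.P.K ∧ S.P.sitesPerDir ((S.K - 1) + 1) = 2 := by
  have hK' : S.K - 1 + 1 = S.K := Nat.sub_add_cancel hK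
  refine ⟨?_, ?_⟩
  · show S.K - 1 + 1 ≤ S.m + S.K
    omega
  · rw [hK']
    exact sitesPerDir_K_of_m_eq_zero S hm

/-- **Such members exist in the family OF RECORD for every depth**: for every odd `L > 1`, `g > 0` and `K ≥ 1` there is a member of record with `m = 0` and that `K`,
whose last run step is an in-range block averaging onto the 2-sites-per-direction torus — and there E6′ is EXACTLY the undecided «T1 =ᵐ 1» question for
print's version (displayed, not decided). [cite: Balaban1985UV3, p.256 L15–18; Balaban1985Averaging, (10) + (15) p.19 (bookkeeping; E6′ NOT IN PRINT)] -/
theorem exists_member_m_zero (hL : Odd L ∧ 1 < L) (g : ℝ) (hg : 0 < g) {K : ℕ} (hK : 1 ≤ K) :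
    ∃ S : Family L (constsOfRecordG N (runObjects₀T N (tOfRecord₃ N L) (Backgrounds.ofPrint N L))).eps0,
      S.1.g = g ∧ S.1.m = 0 ∧ S.1.K = K ∧ (K - 1) + 1 ≤ S.1.P.m + S.1.P.K ∧ S.1.P.sitesPerDir ((K - 1) + 1) = 2 ∧
        ((fieldMeasure S.1.P (K - 1) (SU N)).map (avOfPrint N S.1 (K - 1)).avg = fieldMeasure S.1.P ((K - 1) + 1) (SU N) ↔
          (TOfPrint N S.1 (K - 1)).T 1 =ᵐ[fieldMeasure S.1.P ((K - 1) + 1) (SU N)] 1) := by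
  obtain ⟨S, hSg, hSm, hSK⟩ := exists_member_runsB10OfRecord N hL g hg 0 K
  have h := last_step_in_range_of_m_eq_zero S.1 hSm (hSK ▸ hK)
  rw [hSK] at h
  exact ⟨S, hSg, hSm, hSK, h.1, h.2, map_avOfPrint_eq_iff_TOfPrint_one N S.1 (K - 1)⟩

/-! ## §5. Degenerate-group consistency witness: at `N = 1` E6′ holds at every level -/

/-- `SU(1)` is one point: a `1×1` unitary of determinant `1` is `1`. [folklore] -/
-- adapted from Summits/QuantumFields/BalabanUV/T4Continuum/Support/HistoryRealiseCellsRunAssemblyWTVSJointDatum.lean (`subsingleton_SU1`)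
private theorem subsingleton_SU_one : Subsingleton (SU 1) := by
  refine ⟨fun A B => Subtype.ext ?_⟩
  have hA := A.2
  have hB := B.2
  rw [Matrix.mem_specialUnitaryGroup_iff] at hA hB
  ext i j
  have hi : i = 0 := Subsingleton.elim _ _
  have hj : j = 0 := Subsingleton.elim _ _
  subst hi; subst hj
  rw [← Matrix.det_fin_one (A : Matrix (Fin 1) (Fin 1) ℂ), ← Matrix.det_fin_one (B : Matrix (Fin 1) (Fin 1) ℂ), hA.2, hB.2]

/-- Two probability measures on a one-point configuration space agree. [folklore] -/
private theorem measure_eq_of_subsingleton {α : Type*} [MeasurableSpace α] [Subsingleton α] (μ ν : Measure α)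
    [IsProbabilityMeasure μ] [IsProbabilityMeasure ν] : μ = ν := by
  ext s _
  rcases Set.eq_empty_or_nonempty s with h | h
  · rw [h, measure_empty, measure_empty]
  · rw [Subsingleton.eq_univ_of_nonempty h, measure_univ, measure_univ]

/-- **AT `N = 1` E6′ HOLDS AT EVERY MEMBER AND LEVEL, IN THE STANDING RANGE TOO** (the configuration spaces over `SU(1)` are one point; any measurable
averaging pushes the one probability measure to the other).  A CONSISTENCY witness for the in-range letters — NOT evidence at the pin's `N = 2`.
[cite: Balaban1985Averaging, (10) + (15) p.19 (bookkeeping; degenerate group)] -/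
theorem map_avOfPrint_eq_SU_one (S : Scales L) (j : ℕ) :
    (fieldMeasure S.P j (SU 1)).map (avOfPrint 1 S j).avg = fieldMeasure S.P (j + 1) (SU 1) := by
  haveI : Subsingleton (SU 1) := subsingleton_SU_one
  haveI : Subsingleton (GaugeField S.P (j + 1) (SU 1)) := inferInstanceAs (Subsingleton (PBond S.P (j + 1) → SU 1))
  haveI : IsProbabilityMeasure ((fieldMeasure S.P j (SU 1)).map (avOfPrint 1 S j).avg) :=
    Measure.isProbabilityMeasure_map (measurable_avOfPrint 1 S j).aemeasurable
  exact measure_eq_of_subsingleton _ _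

variable (L) in
/-- … hence at `N = 1` every transformation family of the slot fixes `1` a.e. at every level: both sides of the E6′ biconditional are TRUE there, in range included —
the in-range letters are satisfiable (degenerate group; the record's `N = 2` question is untouched). [cite: Balaban1985Averaging, (10) p.19 (bookkeeping)] -/
theorem T_one_ae_eq_one_SU_one (𝔗 : TFamily₃ 1 L) (S : Scales L) (j : ℕ) :
    (𝔗 S j).T 1 =ᵐ[fieldMeasure S.P (j + 1) (SU 1)] 1 :=
  (map_avOfPrint_eq_iff 1 S j 𝔗).1 (map_avOfPrint_eq_SU_one S j)

end Summit.QuantumFields.YangMills.BalabanUVNodes.N08HaarCompatibilityInhabited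

end
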